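import Literature.NumberTheory.EllipticCurves.Kobayashi2003.SignedSelmerDualUniquenessProofs
import Literature.NumberTheory.EllipticCurves.Tamagawa
import Literature.NumberTheory.EllipticCurves.GlobalMinimalModel
import HarnessLib

/-!
# Kobayashi's Theorem 1.2: the signed Selmer groups `Sel^±(E/ℚ_∞)` are `Λ`-cotorsion

Topic `Literature/NumberTheory/EllipticCurves`, cluster `Kobayashi2003`; sibling of `SignedSelmer.lean`
(p207367: Kobayashi's Def. 1.1 — `E^±(F_{n,𝔭})`, `Sel^±(E/F_n)`, `Sel^±(E/F_∞) = lim→`, and the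
hypothesis structure `SignedSelmerDualData W κ γ ε` for the Pontryagin dual `X^ε(E/K_∞)` with its
`Λ = ℤ_p⟦T⟧`-action, `T = γ - 1`), `SignedSelmerDualExistsProofs.lean` (p207616: such a datum EXISTS
for `γ` a topological generator) and `SignedSelmerDualUniquenessProofs.lean` (p207761: any two data
have `Λ`-isomorphic modules, so "`∀ D : SignedSelmerDualData W κ γ ε, P(D.X)`" for an
isomorphism-invariant `P` says exactly "`P` holds for THE dual of `Sel^ε(E/K_∞)`").

HONEST FRAMING (cell `b2b-bsdres`, harvest seat 2, gen 11; task A-X6-2 (i) of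
`HOME/b2b-bsdres-x10b/X6-ROUTE.md` §2: "named facts Kobayashi Thm 1.2 (Λ-torsion) …"): this file
vendors ONE published theorem as a NAMED FACT (`def … : Prop`, net debt +1), verbatim and in the
special case the source states (`F = ℚ`, the cyclotomic `ℤ_p`-extension, `p` odd, `a_p = 0`), on the
landed objects; nothing about any curve is asserted, nothing is booked, no class label moves.

## Source, read at the page

S. Kobayashi, *Iwasawa theory for elliptic curves at supersingular primes*, Invent. Math. **152**
(2003) 1–36 [corpus: `paper:doi-10-1007-s00222-002-0265-4`, pp. 1–2]. Standing hypotheses (p. 1,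
§1 l. 1–2 and p. 2 l. 1–2): "Let `p` be an odd prime. Let `F = ℚ` and `F_∞/F` the cyclotomic
`ℤ_p`-extension with `n`-th layer `F_n`. We denote `Gal(F_∞/F)` by `Γ`. We identify `ℤ_p[[Γ]]` with
the ring of power series `ℤ_p[[X]]`. … let `E` be an elliptic curve over `ℚ` with good supersingular
reduction at `p`. Suppose `a_p = 0`." Definition 1.1 (p. 2) = `SignedSelmer.lean`. Then (p. 2):
"Let `Sel^±(E/F_∞) := lim→_n Sel^±(E/F_n)`. Then `ℤ_p[[Γ]]` acts naturally on the Pontryagin dual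
of `Sel^±(E/F_∞)`. **Theorem 1.2.** The Pontryagin dual of the even (odd) Selmer group
`Sel^±(E/F_∞)^∨` is a finitely generated torsion `ℤ_p[[Γ]]`-module." (Proof: Thm. 2.2 for the tower
`K_n = ℚ(ζ_{p^{n+1}})`, §6–§9, via the Coleman maps and Kato's Theorem 12.4.)

## Transcription

* `E/ℚ` elliptic, given by a globally minimal Weierstrass equation `W` (`[W.IsElliptic]`,
  `[W.IsGloballyMinimal]`, so that `W.frobeniusTrace p = a_p` and `W.HasGoodReductionAtPrime p` are
  those of `E`); `p ≠ 2`; good reduction at `p` with `a_p = 0` (hence supersingular — the tree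
  spelling of Pollack's file `PlusMinusPAdicLFunction.lean`);
* `κ : ZpExtension ℚ p` with `κ.IsCyclotomic` (the cyclotomic `ℤ_p`-extension `F_∞ = ℚ_∞`) and `γ` a
  topological generator of `Γ` (`κ.IsTopGenerator γ`): Kobayashi's identification
  `ℤ_p[[Γ]] = ℤ_p[[X]]` is `γ ↦ 1 + X`, and "finitely generated torsion over `ℤ_p[[Γ]]`" is the same
  for every choice of topological generator;
* both signs `ε : ℤˣ` (`ε = 1`: even / `+`; `ε = -1`: odd / `−`);
* "the Pontryagin dual `Sel^±(E/F_∞)^∨` with its natural `ℤ_p[[Γ]]`-action" = ANY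
  `D : SignedSelmerDualData W κ γ ε` (exists: `nonempty_signedSelmerDualData`; unique up to
  `Λ`-isomorphism: `SignedSelmerDualData.nonempty_linearEquiv`, and the conclusion is
  isomorphism-invariant: `SignedSelmerDualData.moduleFinite_iff`, `.isTorsion_iff`);
* "finitely generated torsion `ℤ_p[[Γ]]`-module" = Mathlib's `Module.Finite (IwasawaAlgebra p) D.X`
  and `Module.IsTorsion (IwasawaAlgebra p) D.X` (`Λ = IwasawaAlgebra p = ℤ_[p]⟦T⟧`), exactly the
  spelling of the ordinary-case hypotheses in `greenberg_charValue_rankZero` (`IwasawaLeadingTerm`).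

NOT transcribed here (vocabulary of Kobayashi's §2/§4/§9 — the tower `K_n = ℚ(ζ_{p^{n+1}})` with its
`Δ = Gal(K_0/ℚ)`-eigencomponents and the half-cyclotomic polynomials `ω_n^±` — is not in the tree):
Thm. 2.2 (the `η`-component version), Thm. 4.1 (the Kato-side inclusion of the main conjecture) and
Thm. 9.3 (control `X^±_∞/ω_n^± → X^±_n/ω_n^±`). TODO(general form): Thm. 2.2 on the `K`-tower.

## Contents

* `thm12_signedSelmerDual_finite_torsion` — the NAMED FACT (Thm. 1.2 as printed, `F = ℚ`);
* `thm12_signedSelmerDual_finite_torsion.moduleFinite` / `.isTorsion` — the two halves, as functions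
  of the fact (proved: projections);
* `thm12_signedSelmerDual_finite_torsion.exists_finite_torsion` — non-vacuity: granted the fact, for
  `γ` a topological generator there IS a datum and it is finitely generated torsion (proved, from
  `nonempty_signedSelmerDualData`).

References: [Kobayashi2003] Thm. 1.2 (p. 2), Def. 1.1 (p. 2), §1 standing hypotheses (pp. 1–2);
R. Greenberg, LNM 1716 (1999), §1 (the notion "Λ-cotorsion") [GreenbergLNM1716].
-/

noncomputable section

open Literature.NumberTheory.EllipticCurves WeierstrassCurve ZpExtension

namespace Literature.NumberTheory.EllipticCurves.Kobayashi2003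

/-- **Kobayashi's Theorem 1.2 (the signed Selmer groups are `Λ`-cotorsion), as printed, `F = ℚ`.**
"Let `p` be an odd prime. Let `F = ℚ` and `F_∞/F` the cyclotomic `ℤ_p`-extension … let `E` be an
elliptic curve over `ℚ` with good supersingular reduction at `p`. Suppose `a_p = 0`. … Let
`Sel^±(E/F_∞) := lim→_n Sel^±(E/F_n)`. Then `ℤ_p[[Γ]]` acts naturally on the Pontryagin dual of
`Sel^±(E/F_∞)`. **Theorem 1.2.** The Pontryagin dual of the even (odd) Selmer group `Sel^±(E/F_∞)^∨`
is a finitely generated torsion `ℤ_p[[Γ]]`-module." In the tree's spelling: for `W/ℚ` elliptic and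
globally minimal, `p ≠ 2` of good reduction with `a_p = W.frobeniusTrace p = 0`, the cyclotomic
`ℤ_p`-extension `κ` with a topological generator `γ` (`Λ = ℤ_p⟦T⟧`, `T = γ - 1`), either sign `ε`, and
ANY Pontryagin-dual datum `D : SignedSelmerDualData W κ γ ε` of `Sel^ε(E/ℚ_∞)` (Def. 1.1,
`SignedSelmer.lean`; such data exist and are unique up to `Λ`-isomorphism —
`nonempty_signedSelmerDualData`, `SignedSelmerDualData.nonempty_linearEquiv`), the `Λ`-module `D.X`
is finitely generated (`Module.Finite`) and torsion (`Module.IsTorsion`). Nothing else is asserted;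
the `K`-tower / `η`-component form (Thm. 2.2) is not transcribed.
[cite: Kobayashi2003, Thm. 1.2 (p. 2; standing hypotheses pp. 1–2; corpus `paper:doi-10-1007-s00222-002-0265-4` p0002)] -/
def thm12_signedSelmerDual_finite_torsion : Prop :=
  ∀ (W : WeierstrassCurve ℚ) [W.IsElliptic] [W.IsGloballyMinimal] (p : ℕ) [Fact p.Prime],
      p ≠ 2 → W.HasGoodReductionAtPrime p → W.frobeniusTrace p = 0 →
      ∀ (κ : ZpExtension ℚ p) (γ : Field.absoluteGaloisGroup ℚ),
        κ.IsCyclotomic → κ.IsTopGenerator γ →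
      ∀ (ε : ℤˣ) (D : SignedSelmerDualData W κ γ ε),
        Module.Finite (IwasawaAlgebra p) D.X ∧ Module.IsTorsion (IwasawaAlgebra p) D.X

namespace thm12_signedSelmerDual_finite_torsion

/-- First half of Thm. 1.2 as a function of the fact: `X^ε(E/ℚ_∞)` is a finitely generated
`Λ`-module. [cite: Kobayashi2003, Thm. 1.2 (p. 2)] -/
theorem moduleFinite (h : thm12_signedSelmerDual_finite_torsion)
    {W : WeierstrassCurve ℚ} [W.IsElliptic] [W.IsGloballyMinimal] {p : ℕ} [Fact p.Prime]
    (hp : p ≠ 2) (hgood : W.HasGoodReductionAtPrime p) (hap : W.frobeniusTrace p = 0)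
    {κ : ZpExtension ℚ p} {γ : Field.absoluteGaloisGroup ℚ} (hκ : κ.IsCyclotomic)
    (hγ : κ.IsTopGenerator γ) {ε : ℤˣ} (D : SignedSelmerDualData W κ γ ε) :
    Module.Finite (IwasawaAlgebra p) D.X :=
  (h W p hp hgood hap κ γ hκ hγ ε D).1

/-- Second half of Thm. 1.2 as a function of the fact: `X^ε(E/ℚ_∞)` is a torsion `Λ`-module
("`Sel^ε(E/ℚ_∞)` is `Λ`-cotorsion"). [cite: Kobayashi2003, Thm. 1.2 (p. 2)] -/
theorem isTorsion (h : thm12_signedSelmerDual_finite_torsion)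
    {W : WeierstrassCurve ℚ} [W.IsElliptic] [W.IsGloballyMinimal] {p : ℕ} [Fact p.Prime]
    (hp : p ≠ 2) (hgood : W.HasGoodReductionAtPrime p) (hap : W.frobeniusTrace p = 0)
    {κ : ZpExtension ℚ p} {γ : Field.absoluteGaloisGroup ℚ} (hκ : κ.IsCyclotomic)
    (hγ : κ.IsTopGenerator γ) {ε : ℤˣ} (D : SignedSelmerDualData W κ γ ε) :
    Module.IsTorsion (IwasawaAlgebra p) D.X :=
  (h W p hp hgood hap κ γ hκ hγ ε D).2

/-- Non-vacuity of the fact: for `γ` a topological generator a Pontryagin-dual datum of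
`Sel^ε(E/ℚ_∞)` EXISTS (`nonempty_signedSelmerDualData`), so Thm. 1.2 produces an actual finitely
generated torsion `Λ`-module `X^ε(E/ℚ_∞)`. [cite: Kobayashi2003, Thm. 1.2 (p. 2)] -/
theorem exists_finite_torsion (h : thm12_signedSelmerDual_finite_torsion)
    {W : WeierstrassCurve ℚ} [W.IsElliptic] [W.IsGloballyMinimal] {p : ℕ} [Fact p.Prime]
    (hp : p ≠ 2) (hgood : W.HasGoodReductionAtPrime p) (hap : W.frobeniusTrace p = 0)
    {κ : ZpExtension ℚ p} {γ : Field.absoluteGaloisGroup ℚ} (hκ : κ.IsCyclotomic)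
    (hγ : κ.IsTopGenerator γ) (ε : ℤˣ) :
    ∃ D : SignedSelmerDualData W κ γ ε,
      Module.Finite (IwasawaAlgebra p) D.X ∧ Module.IsTorsion (IwasawaAlgebra p) D.X := by
  obtain ⟨D⟩ := nonempty_signedSelmerDualData W κ ε hγ
  exact ⟨D, h W p hp hgood hap κ γ hκ hγ ε D⟩

end thm12_signedSelmerDual_finite_torsion

end Literature.NumberTheory.EllipticCurves.Kobayashi2003

end
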